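import Summits.ABC.ABC.Theses.DefiniteXi
import Literature.NumberTheory.Automorphic.BrandtSetupAdmissible
import Literature.NumberTheory.Automorphic.BrandtXiSetupIndependence
import Literature.NumberTheory.EllipticCurves.TakahashiDegreeFormula

/-!
# `XiBound` (stmt-ABC-11336, route ABC/DefiniteXi) — negative-side lemmas III: the Takahashi squeeze

Standing-adversary (cdisprove) output for the crux `Summit.ABC.ABC.Theses.DefiniteXi.XiBound`.  From the
tree's named fact `takahashi2001_thm_2_3` (S. Takahashi, J. Number Theory 90 (2001), Thm 2.3 p. 79 with
Thm 3.8 p. 84: `δ i = h_r j`, `i j = c_r`, `0 < i`, for the optimal quotient of squarefree conductor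
`N = M r` and every Brandt setup of type `(M, r)`):

* `xi_le_modularDegree_mul_ord`, `brandtXi_le_modularDegree_mul_ord` — **`ξ_S ≤ δ_opt · ord_r Δ_min`**,
  the converse companion of the tree's `takahashi2001_thm_2_3.modularDegree_le_xi_mul`
  (`δ_opt ≤ ξ_S · ord_r Δ_min`): on semistable curves with prime `N⁻ = r`,
  `δ_opt / c_r ≤ ξ ≤ δ_opt · c_r`;
* `modularDegree_gt_of_xi_gt` — large `ξ` forces large optimal degree;
* `not_xiBound_of_superpolynomial_optimal_degrees` — **refutation schema**: a family, indexed by all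
  `(A, C)`, of `X₀(N)`-optimal curves sharing the (isogeny-invariant) L-function of a Frey curve of
  squarefree conductor `N = M r` with `δ_opt > C · N^A · ord_r Δ_min` refutes `XiBound` — no
  Jacquet–Langlands input needed in this direction.

Upshot (both directions, modulo the fact): on its prime-`N⁻` / semistable part, `XiBound` fails iff optimal
modular degrees of Frey classes are superpolynomial relative to `ord_r Δ_min ≤ log₂|Δ_min|` — the polynomial
modular-degree conjecture, equivalently polynomial Szpiro on Frey curves (route item `PolyFreyDegree`): the
crux is abc-hard in both directions.  Refuter seat cdisprove-stmt-ABC-11336-g2, 2026-08-15.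
-/

namespace Summit.ABC.ABC.Theorems.XiBound.Negative

open Literature.NumberTheory.Automorphic Literature.NumberTheory.EllipticCurves
open Literature.NumberTheory.EllipticCurves.ModularForms
open Summit.ABC.ABC.Theses.DefiniteXi

/-- **`ξ_S ≤ δ_opt · ord_r Δ_min` in every Brandt setup** (Takahashi 2001 Thm 2.3: from `δ i = h_r j`,
`i j = c_r`, `0 < i` one gets `j ≥ 1` since `δ i ≥ 1`, hence `ξ ≤ ξ j = δ i ≤ δ c_r`).  The modular degree
of the optimal curve controls the definite congruence number from above, with no Eisenstein-prime input.
[cite: Takahashi2001, Thm. 2.3] -/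
theorem xi_le_modularDegree_mul_ord (h : takahashi2001_thm_2_3) (W : WeierstrassCurve ℚ) [W.IsElliptic]
    (M r : ℕ) [NeZero (M * r)] (hr : r.Prime) (hsq : Squarefree (M * r))
    (hN : W.conductorNorm ℤ = M * r) (P : ModularParametrizationData W (M * r))
    (hmin : ∀ (W' : WeierstrassCurve ℚ) [W'.IsElliptic] (P' : ModularParametrizationData W' (M * r)),
      P'.f = P.f → P.modularDegree ≤ P'.modularDegree)
    (S : Brandt.XiSetup M r) :
    S.xi (fun n => W.LFunction n) ≤ P.modularDegree * (W.minimalDiscriminantNorm ℤ).factorization r := by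
  obtain ⟨i, j, hi, hij, -, hδ⟩ := h W M r hr hsq hN P hmin S
  have hdeg : 0 < P.modularDegree := P.deg_pos
  have hj : 0 < j := by
    rcases Nat.eq_zero_or_pos j with rfl | hj
    · rw [mul_zero] at hδ
      exact absurd hδ (Nat.mul_ne_zero hdeg.ne' hi.ne')
    · exact hj
  calc S.xi (fun n => W.LFunction n)
      ≤ S.xi (fun n => W.LFunction n) * j := Nat.le_mul_of_pos_right _ hj
    _ = P.modularDegree * i := hδ.symm
    _ ≤ P.modularDegree * (i * j) := Nat.mul_le_mul_left _ (Nat.le_mul_of_pos_right _ hj)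
    _ = _ := by rw [hij]

/-- `brandtXi` form of `xi_le_modularDegree_mul_ord` (under the fact's hypotheses a setup of type
`(M, r)` exists, `Brandt.nonempty_xiSetup_of_squarefree_mul`, and every setup computes `brandtXi`,
`Brandt.XiSetup.brandtXi_eq_xi`). [cite: Takahashi2001, Thm. 2.3] -/
theorem brandtXi_le_modularDegree_mul_ord (h : takahashi2001_thm_2_3) (W : WeierstrassCurve ℚ)
    [W.IsElliptic] (M r : ℕ) [NeZero (M * r)] (hr : r.Prime) (hsq : Squarefree (M * r))
    (hN : W.conductorNorm ℤ = M * r) (P : ModularParametrizationData W (M * r))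
    (hmin : ∀ (W' : WeierstrassCurve ℚ) [W'.IsElliptic] (P' : ModularParametrizationData W' (M * r)),
      P'.f = P.f → P.modularDegree ≤ P'.modularDegree) :
    brandtXi M r (fun n => W.LFunction n) ≤
      P.modularDegree * (W.minimalDiscriminantNorm ℤ).factorization r := by
  have hodd : Odd r.primeFactors.card := by rw [hr.primeFactors]; simp
  obtain ⟨S⟩ := Brandt.nonempty_xiSetup_of_squarefree_mul (Nplus := M) (Nminus := r) hsq hodd
  rw [S.brandtXi_eq_xi]
  exact xi_le_modularDegree_mul_ord h W M r hr hsq hN P hmin S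

/-- **Large `ξ` forces large optimal degree**: `B · ord_r Δ_min < ξ_S` implies `B < δ_opt`. [cite: Takahashi2001, Thm. 2.3] -/
theorem modularDegree_gt_of_xi_gt (h : takahashi2001_thm_2_3) (W : WeierstrassCurve ℚ) [W.IsElliptic]
    (M r : ℕ) [NeZero (M * r)] (hr : r.Prime) (hsq : Squarefree (M * r))
    (hN : W.conductorNorm ℤ = M * r) (P : ModularParametrizationData W (M * r))
    (hmin : ∀ (W' : WeierstrassCurve ℚ) [W'.IsElliptic] (P' : ModularParametrizationData W' (M * r)),
      P'.f = P.f → P.modularDegree ≤ P'.modularDegree)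
    (S : Brandt.XiSetup M r) {B : ℕ}
    (hB : B * (W.minimalDiscriminantNorm ℤ).factorization r < S.xi (fun n => W.LFunction n)) :
    B < P.modularDegree :=
  Nat.lt_of_mul_lt_mul_right (hB.trans_le (xi_le_modularDegree_mul_ord h W M r hr hsq hN P hmin S))

/-- **Refutation schema** (the converse lock).  Given Takahashi's theorem, `XiBound` is refuted by any
family, indexed by all `A` and `C ≥ 0`, of `X₀(N)`-OPTIMAL curves `W` with the L-function of a Frey curve
`E_(a,b)` (`a, b` coprime, `ab(a+b) ≠ 0`) of squarefree conductor `N = M · r`, `r` an odd prime, whose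
optimal degree beats `C · N^A · ord_r Δ_min(W)`: the tree's `takahashi2001_thm_2_3.modularDegree_le_xi_mul`
(`δ ≤ ξ_S · c_r`) turns it into `ξ_S(a(E)) > C N^A`, and `ξ` only sees the isogeny-invariant eigenvalue
system (the Frey model versus the optimal curve is immaterial here).  No Jacquet–Langlands input: the fact's
`0 < i`, `δ i = ξ j` already certify `ξ ≠ 0`. [cite: Takahashi2001, Thm. 2.3] -/
theorem not_xiBound_of_superpolynomial_optimal_degrees (h : takahashi2001_thm_2_3)
    (hfam : ∀ A C : ℝ, 0 ≤ C → ∃ a b : ℤ, IsCoprime a b ∧ a * b * (a + b) ≠ 0 ∧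
      ∃ M r : ℕ, r.Prime ∧ r ≠ 2 ∧ (freyCurve a b).conductorNorm ℤ = M * r ∧ Squarefree (M * r) ∧
      ∃ (W : WeierstrassCurve ℚ) (_ : W.IsElliptic),
        (∀ n, W.LFunction n = (freyCurve a b).LFunction n) ∧ W.conductorNorm ℤ = M * r ∧
        ∃ (_ : NeZero (M * r)) (P : ModularParametrizationData W (M * r)),
          (∀ (W' : WeierstrassCurve ℚ) [W'.IsElliptic] (P' : ModularParametrizationData W' (M * r)),
              P'.f = P.f → P.modularDegree ≤ P'.modularDegree) ∧
          C * ((M * r : ℕ) : ℝ) ^ A * ((W.minimalDiscriminantNorm ℤ).factorization r : ℕ) <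
            (P.modularDegree : ℝ)) :
    ¬ XiBound := by
  rintro ⟨A, C, hX⟩
  -- WLOG `0 ≤ C`
  have hX' : ∀ a b : ℤ, IsCoprime a b → a * b * (a + b) ≠ 0 → ∀ (N : ℕ) [NeZero N],
      (freyCurve a b).conductorNorm ℤ = N → ∀ Nm : ℕ, Odd Nm → Squarefree Nm →
      Odd Nm.primeFactors.card → Nm ∣ N →
      (brandtXi (N / Nm) Nm (fun n => (freyCurve a b).LFunction n) : ℝ) ≤ max C 0 * (N : ℝ) ^ A :=
    fun a b hab h0 N _ hN Nm h1 h2 h3 h4 => (hX a b hab h0 N hN Nm h1 h2 h3 h4).trans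
      (mul_le_mul_of_nonneg_right (le_max_left _ _) (Real.rpow_nonneg (Nat.cast_nonneg _) _))
  obtain ⟨a, b, hab, h0, M, r, hr, hr2, hMr, hsq, W, hW, hL, hNW, hne, P, hmin, hlt⟩ :=
    hfam A (max C 0) (le_max_right _ _)
  haveI := hW
  haveI := hne
  have hodd : Odd r.primeFactors.card := by rw [hr.primeFactors]; simp
  obtain ⟨S⟩ := Brandt.nonempty_xiSetup_of_squarefree_mul (Nplus := M) (Nminus := r) hsq hodd
  have hδ : P.modularDegree ≤
      S.xi (fun n => W.LFunction n) * (W.minimalDiscriminantNorm ℤ).factorization r :=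
    h.modularDegree_le_xi_mul W M r hr hsq hNW P hmin S
  have hlam : (fun n => W.LFunction n) = fun n => (freyCurve a b).LFunction n := funext hL
  rw [hlam] at hδ
  have hinst := hX' a b hab h0 (M * r) hMr r (hr.odd_of_ne_two hr2) (Irreducible.squarefree hr) hodd
    (Dvd.intro_left M rfl)
  rw [Nat.mul_div_cancel _ hr.pos, S.brandtXi_eq_xi] at hinst
  have hc : (0 : ℝ) ≤ ((W.minimalDiscriminantNorm ℤ).factorization r : ℕ) := Nat.cast_nonneg _
  have hle : (P.modularDegree : ℝ) ≤
      max C 0 * ((M * r : ℕ) : ℝ) ^ A * ((W.minimalDiscriminantNorm ℤ).factorization r : ℕ) :=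
    calc (P.modularDegree : ℝ)
        ≤ (S.xi (fun n => (freyCurve a b).LFunction n) : ℝ) *
            ((W.minimalDiscriminantNorm ℤ).factorization r : ℕ) := by exact_mod_cast hδ
      _ ≤ _ := mul_le_mul_of_nonneg_right hinst hc
  exact (not_le.mpr hlt) hle

end Summit.ABC.ABC.Theorems.XiBound.Negative
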